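import Mathlib
import Summits.AtomisticToContinuum.FouriersLaw.Theses.EmbeddedDrudeMourre
import Literature.MathematicalPhysics.KineticTheory.PhononPairBand
import HarnessLib

/-!
# Geometry of the free pair resonance for stub B1b″ of line `kinetic-polymer-gas-on-the-time-axis`:
# transversality of the resonant sheet inside the exchange planes and at the triple points
(crux `EmbeddedDrudeMourre.DrudeDissolution`, item stmt-AtomisticToContinuum-12593; `--supports` file, closes
nothing; lead c13, geometry inputs (G-E1), (G-I1)=(G-I2), (G-I3) of the B1b″ floor)

WHAT. Write `Ω = A·S₁·S₂` on the cell (`Sᵢ` the half-angle sines of the distances to the two exchange planes,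
`A = 8H/((Σω)(ω₁ω₂+ω₃ω₄))`, sibling crux's `stub_resonanceFactorisation`). The floor `|∇Ω|² ≥ c·(A²S₁²+A²S₂²+S₁²S₂²)`
of the second-difference estimate B1b″ needs the zero set of the restriction of `H` to an exchange plane,
`H₀(k₁,k₂) := 2(ω(k₁)ω(k₂) + ω₂ + 2)cos((k₁+k₂)/2) − 4cos((k₁−k₂)/2)`
(the same function on both planes), to be a REGULAR curve away from the triple points, and `H` to be transversal
to the diagonal at the triple points. This file proves:

* `sheetFn_plane_identity` (G-E1): `sin((k₂−k₁)/2)·H₀(k₁,k₂) = (v(k₂) − v(k₁))·(ω(k₁)+ω(k₂))ω(k₁)ω(k₂)` — so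
  `{H₀ = 0}` is the co-moving curve `{v(k₁) = v(k₂)}` with the diagonal removed except at `cos k = c*`;
* `sheetFn_plane_transversal` (G-I1): `H₀(k₁,k₂) = 0 ∧ ∇H₀(k₁,k₂) = 0 ⇒ cos k₁ = cos k₂ = c* = cosKappaStar ω₂`
  (the triple points `(±k*,±k*)`): differentiate (G-E1), use `(ω₁+ω₂)ω₁ω₂ > 0`, `v(k₂) = v(k₁)` at a zero, and
  `v′(k) = 0 ⇔ cos k = c*` (`deriv_groupVelocity_eq_zero_iff_cos`);
* `sheetFn_diag_hasDerivAt` / `sheetFn_diag_deriv_ne_zero` (G-I3): along the diagonal,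
  `t ↦ H(k+t,k+t,k+t) = 2(ω(k+t)² + ω₂ + 2)cos(k+t) − 4` has derivative `4 sin k (2cos k − ω₂ − 2)`, which at
  `cos k = c*` equals `−4 sin k √((ω₂+2)² − 4) ≠ 0`.

HOW. Trigonometric algebra (`sin k₂ − sin k₁ = 2cos((k₁+k₂)/2)sin((k₂−k₁)/2)`, `ω² = ω₂ + 2 − 2cos`), the
product rule for Fréchet derivatives, `hasDerivAt_groupVelocity`, `cosKappaStar_quadratic`.
-/

noncomputable section

open Set Real Topology
open Literature.MathematicalPhysics.KineticTheory
open Literature.MathematicalPhysics.KineticTheory.PhononBoltzmann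

namespace Summit.AtomisticToContinuum.FouriersLaw.Theorems.DrudeDissolution.KineticPolymerGasOnTheTimeAxis

/-! ### (G-E1) The plane identity -/

/-- **Registered sub-goal `sheetFn_plane_identity` (G-E1): the restricted sheet function is the velocity
mismatch.** For `ω₂ ≥ 0` and all `k₁ k₂`:
`sin((k₂−k₁)/2)·(2(ω(k₁)ω(k₂)+ω₂+2)cos((k₁+k₂)/2) − 4cos((k₁−k₂)/2)) = (v(k₂) − v(k₁))·(ω(k₁)+ω(k₂))·ω(k₁)·ω(k₂)`
(`ω = dispersion ω₂`, `v = groupVelocity ω₂ = sin/ω`). [folklore] -/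
theorem sheetFn_plane_identity :
    ∀ ω₂ : ℝ, 0 < ω₂ → ∀ k₁ k₂ : ℝ,
      Real.sin ((k₂ - k₁) / 2) *
          (2 * (dispersion ω₂ k₁ * dispersion ω₂ k₂ + ω₂ + 2) * Real.cos ((k₁ + k₂) / 2) -
            4 * Real.cos ((k₁ - k₂) / 2)) =
        (groupVelocity ω₂ k₂ - groupVelocity ω₂ k₁) *
          ((dispersion ω₂ k₁ + dispersion ω₂ k₂) * dispersion ω₂ k₁ * dispersion ω₂ k₂) := by
  intro ω₂ hω k₁ k₂
  have h1 := dispersion_pos hω k₁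
  have h2 := dispersion_pos hω k₂
  have s1 := dispersion_sq hω.le k₁
  have s2 := dispersion_sq hω.le k₂
  unfold groupVelocity
  rw [div_sub_div _ _ h2.ne' h1.ne']
  rw [div_mul_eq_mul_div, eq_div_iff (mul_pos h2 h1).ne']
  -- trigonometric expansions around the half angles
  have hsin : Real.sin k₂ - Real.sin k₁ = 2 * Real.cos ((k₁ + k₂) / 2) * Real.sin ((k₂ - k₁) / 2) := by
    rw [show k₂ = (k₁ + k₂) / 2 + (k₂ - k₁) / 2 by ring, show k₁ = (k₁ + k₂) / 2 - (k₂ - k₁) / 2 by ring]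
    rw [Real.sin_add, Real.sin_sub]
    ring_nf
  have hsd : Real.sin (k₂ - k₁) = 2 * Real.sin ((k₂ - k₁) / 2) * Real.cos ((k₂ - k₁) / 2) := by
    rw [show k₂ - k₁ = 2 * ((k₂ - k₁) / 2) by ring, Real.sin_two_mul]
    ring_nf
  have hcd : Real.cos ((k₁ - k₂) / 2) = Real.cos ((k₂ - k₁) / 2) := by
    rw [show (k₁ - k₂) / 2 = -((k₂ - k₁) / 2) by ring, Real.cos_neg]
  have hsd' : Real.sin (k₂ - k₁) = Real.sin k₂ * Real.cos k₁ - Real.cos k₂ * Real.sin k₁ := Real.sin_sub _ _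
  -- `(sin k₂ ω₁ − sin k₁ ω₂)(ω₁ + ω₂) = (ω₂+2+ω₁ω₂)(sin k₂ − sin k₁) − 2 sin(k₂ − k₁)`
  have key : (Real.sin k₂ * dispersion ω₂ k₁ - dispersion ω₂ k₂ * Real.sin k₁) *
      ((dispersion ω₂ k₁ + dispersion ω₂ k₂) * dispersion ω₂ k₁ * dispersion ω₂ k₂) =
      ((ω₂ + 2 + dispersion ω₂ k₁ * dispersion ω₂ k₂) * (Real.sin k₂ - Real.sin k₁) - 2 * Real.sin (k₂ - k₁)) *
        (dispersion ω₂ k₂ * dispersion ω₂ k₁) := by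
    rw [hsd']
    have e1 : dispersion ω₂ k₁ ^ 2 = ω₂ + 2 - 2 * Real.cos k₁ := by rw [s1]; ring
    have e2 : dispersion ω₂ k₂ ^ 2 = ω₂ + 2 - 2 * Real.cos k₂ := by rw [s2]; ring
    have : (Real.sin k₂ * dispersion ω₂ k₁ - dispersion ω₂ k₂ * Real.sin k₁) * (dispersion ω₂ k₁ + dispersion ω₂ k₂) =
        Real.sin k₂ * dispersion ω₂ k₁ ^ 2 - Real.sin k₁ * dispersion ω₂ k₂ ^ 2 +
          dispersion ω₂ k₁ * dispersion ω₂ k₂ * (Real.sin k₂ - Real.sin k₁) := by ring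
    calc (Real.sin k₂ * dispersion ω₂ k₁ - dispersion ω₂ k₂ * Real.sin k₁) *
          ((dispersion ω₂ k₁ + dispersion ω₂ k₂) * dispersion ω₂ k₁ * dispersion ω₂ k₂)
        = ((Real.sin k₂ * dispersion ω₂ k₁ - dispersion ω₂ k₂ * Real.sin k₁) * (dispersion ω₂ k₁ + dispersion ω₂ k₂)) *
            (dispersion ω₂ k₂ * dispersion ω₂ k₁) := by ring
      _ = (Real.sin k₂ * dispersion ω₂ k₁ ^ 2 - Real.sin k₁ * dispersion ω₂ k₂ ^ 2 +
            dispersion ω₂ k₁ * dispersion ω₂ k₂ * (Real.sin k₂ - Real.sin k₁)) * (dispersion ω₂ k₂ * dispersion ω₂ k₁) := by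
          rw [this]
      _ = ((ω₂ + 2 + dispersion ω₂ k₁ * dispersion ω₂ k₂) * (Real.sin k₂ - Real.sin k₁) -
            2 * (Real.sin k₂ * Real.cos k₁ - Real.cos k₂ * Real.sin k₁)) * (dispersion ω₂ k₂ * dispersion ω₂ k₁) := by
          rw [e1, e2]; ring
  rw [key, hsin, hsd, hcd]
  ring

/-- At a zero of the restricted sheet function the two group velocities agree. [folklore] -/
theorem groupVelocity_eq_of_sheetFn_plane_eq_zero {ω₂ : ℝ} (hω : 0 < ω₂) {k₁ k₂ : ℝ}
    (h : 2 * (dispersion ω₂ k₁ * dispersion ω₂ k₂ + ω₂ + 2) * Real.cos ((k₁ + k₂) / 2) -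
      4 * Real.cos ((k₁ - k₂) / 2) = 0) :
    groupVelocity ω₂ k₂ = groupVelocity ω₂ k₁ := by
  have e := sheetFn_plane_identity ω₂ hω k₁ k₂
  rw [h, mul_zero] at e
  have hG : 0 < (dispersion ω₂ k₁ + dispersion ω₂ k₂) * dispersion ω₂ k₁ * dispersion ω₂ k₂ :=
    mul_pos (mul_pos (add_pos (dispersion_pos hω k₁) (dispersion_pos hω k₂)) (dispersion_pos hω k₁))
      (dispersion_pos hω k₂)
  have := (mul_eq_zero.1 e.symm).resolve_right hG.ne'
  linarith

/-! ### (G-I1) Regularity of the restricted sheet away from the triple points -/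

/-- **Registered sub-goal `sheetFn_plane_transversal` (G-I1) = (G-I2): the resonant sheet meets each exchange
plane in a regular curve away from the triple points.** For `ω₂ > 0`: if
`H₀(k₁,k₂) = 2(ω(k₁)ω(k₂)+ω₂+2)cos((k₁+k₂)/2) − 4cos((k₁−k₂)/2)` vanishes at `(k₁,k₂)` together with its Fréchet
derivative, then `cos k₁ = cos k₂ = c* = cosKappaStar ω₂` (and `v(k₁) = v(k₂)`), i.e. `(k₁,k₂) ≡ (±k*, ±k*)` is a
triple point. [folklore] -/
theorem sheetFn_plane_transversal :
    ∀ ω₂ : ℝ, 0 < ω₂ → ∀ k₁ k₂ : ℝ,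
      2 * (dispersion ω₂ k₁ * dispersion ω₂ k₂ + ω₂ + 2) * Real.cos ((k₁ + k₂) / 2) -
          4 * Real.cos ((k₁ - k₂) / 2) = 0 →
      fderiv ℝ (fun q : ℝ × ℝ => 2 * (dispersion ω₂ q.1 * dispersion ω₂ q.2 + ω₂ + 2) * Real.cos ((q.1 + q.2) / 2) -
          4 * Real.cos ((q.1 - q.2) / 2)) (k₁, k₂) = 0 →
      Real.cos k₁ = cosKappaStar ω₂ ∧ Real.cos k₂ = cosKappaStar ω₂ := by
  intro ω₂ hω k₁ k₂ hH hDH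
  -- differentiability of the band and of the pieces
  have hd : Differentiable ℝ (dispersion ω₂) := fun k => (hasDerivAt_dispersion hω k).differentiableAt
  have hv : Differentiable ℝ (groupVelocity ω₂) := fun k => (hasDerivAt_groupVelocity hω k).differentiableAt
  set Hf : ℝ × ℝ → ℝ := fun q => 2 * (dispersion ω₂ q.1 * dispersion ω₂ q.2 + ω₂ + 2) * Real.cos ((q.1 + q.2) / 2) -
      4 * Real.cos ((q.1 - q.2) / 2) with hHf
  set Sf : ℝ × ℝ → ℝ := fun q => Real.sin ((q.2 - q.1) / 2) with hSf
  set Df : ℝ × ℝ → ℝ := fun q => groupVelocity ω₂ q.2 - groupVelocity ω₂ q.1 with hDf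
  set Gf : ℝ × ℝ → ℝ := fun q => (dispersion ω₂ q.1 + dispersion ω₂ q.2) * dispersion ω₂ q.1 * dispersion ω₂ q.2
    with hGf
  have hHd : DifferentiableAt ℝ Hf (k₁, k₂) := by
    rw [hHf]
    have c1 : Differentiable ℝ fun q : ℝ × ℝ => dispersion ω₂ q.1 := hd.comp differentiable_fst
    have c2 : Differentiable ℝ fun q : ℝ × ℝ => dispersion ω₂ q.2 := hd.comp differentiable_snd
    have c3 : Differentiable ℝ fun q : ℝ × ℝ => Real.cos ((q.1 + q.2) / 2) := by fun_prop
    have c4 : Differentiable ℝ fun q : ℝ × ℝ => 4 * Real.cos ((q.1 - q.2) / 2) := by fun_prop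
    have c5 : Differentiable ℝ fun q : ℝ × ℝ => 2 * (dispersion ω₂ q.1 * dispersion ω₂ q.2 + ω₂ + 2) := by
      have := ((c1.mul c2).add_const ω₂).add_const 2
      exact this.const_mul 2
    exact ((c5.mul c3).sub c4).differentiableAt
  have hSd : DifferentiableAt ℝ Sf (k₁, k₂) := by rw [hSf]; fun_prop
  have hDd : DifferentiableAt ℝ Df (k₁, k₂) := by
    rw [hDf]
    exact ((hv.comp differentiable_snd).sub (hv.comp differentiable_fst)).differentiableAt
  have hGd : DifferentiableAt ℝ Gf (k₁, k₂) := by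
    rw [hGf]
    have c1 : Differentiable ℝ fun q : ℝ × ℝ => dispersion ω₂ q.1 := hd.comp differentiable_fst
    have c2 : Differentiable ℝ fun q : ℝ × ℝ => dispersion ω₂ q.2 := hd.comp differentiable_snd
    exact (((c1.add c2).mul c1).mul c2).differentiableAt
  -- the identity (G-E1) as an equality of functions
  have hE : Sf * Hf = Df * Gf := by
    funext q
    simp only [Pi.mul_apply, hSf, hHf, hDf, hGf]
    exact sheetFn_plane_identity ω₂ hω q.1 q.2
  -- values at the point
  have hH0 : Hf (k₁, k₂) = 0 := hH
  have hD0 : Df (k₁, k₂) = 0 := by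
    simp only [hDf]
    rw [groupVelocity_eq_of_sheetFn_plane_eq_zero hω hH, sub_self]
  have hG0 : Gf (k₁, k₂) ≠ 0 := by
    simp only [hGf]
    exact (mul_pos (mul_pos (add_pos (dispersion_pos hω k₁) (dispersion_pos hω k₂)) (dispersion_pos hω k₁))
      (dispersion_pos hω k₂)).ne'
  -- differentiate the identity at the point
  have hL : fderiv ℝ (Sf * Hf) (k₁, k₂) = 0 := by
    rw [fderiv_mul hSd hHd, hH0, hDH, zero_smul, smul_zero, add_zero]
  have hR : fderiv ℝ (Df * Gf) (k₁, k₂) = Gf (k₁, k₂) • fderiv ℝ Df (k₁, k₂) := by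
    rw [fderiv_mul hDd hGd, hD0, zero_smul, zero_add]
  rw [hE] at hL
  rw [hL] at hR
  have hDF : fderiv ℝ Df (k₁, k₂) = 0 := by
    have := hR.symm
    rwa [smul_eq_zero, or_iff_right hG0] at this
  -- the two partials of `Df` are `−v′(k₁)` and `v′(k₂)`
  have hfst : HasFDerivAt (groupVelocity ω₂ ∘ Prod.fst)
      (deriv (groupVelocity ω₂) k₁ • ContinuousLinearMap.fst ℝ ℝ ℝ) (k₁, k₂) :=
    HasDerivAt.comp_hasFDerivAt (k₁, k₂) ((hv k₁).hasDerivAt) hasFDerivAt_fst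
  have hsnd : HasFDerivAt (groupVelocity ω₂ ∘ Prod.snd)
      (deriv (groupVelocity ω₂) k₂ • ContinuousLinearMap.snd ℝ ℝ ℝ) (k₁, k₂) :=
    HasDerivAt.comp_hasFDerivAt (k₁, k₂) ((hv k₂).hasDerivAt) hasFDerivAt_snd
  have hD' : HasFDerivAt Df (deriv (groupVelocity ω₂) k₂ • ContinuousLinearMap.snd ℝ ℝ ℝ -
        deriv (groupVelocity ω₂) k₁ • ContinuousLinearMap.fst ℝ ℝ ℝ) (k₁, k₂) := by
    rw [hDf]
    exact hsnd.sub hfst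
  have hDF' : fderiv ℝ Df (k₁, k₂) =
      deriv (groupVelocity ω₂) k₂ • ContinuousLinearMap.snd ℝ ℝ ℝ -
        deriv (groupVelocity ω₂) k₁ • ContinuousLinearMap.fst ℝ ℝ ℝ := hD'.fderiv
  rw [hDF'] at hDF
  have e1 := congrArg (fun L : ℝ × ℝ →L[ℝ] ℝ => L (1, 0)) hDF
  have e2 := congrArg (fun L : ℝ × ℝ →L[ℝ] ℝ => L (0, 1)) hDF
  simp only [sub_apply, smul_apply, ContinuousLinearMap.coe_fst', ContinuousLinearMap.coe_snd',
    smul_eq_mul, mul_one, mul_zero, sub_zero, zero_sub, zero_apply, neg_eq_zero] at e1 e2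
  exact ⟨(deriv_groupVelocity_eq_zero_iff_cos hω k₁).1 e1, (deriv_groupVelocity_eq_zero_iff_cos hω k₂).1 e2⟩

/-! ### (G-I3) Transversality of the sheet to the diagonal at the triple points -/

/-- **The sheet function along the diagonal.** For `ω₂ ≥ 0`,
`d/dt [2(ω(k+t)² + ω₂ + 2)cos(k+t) − 4] |_{t=0} = 4 sin k (2cos k − ω₂ − 2)` (the value of the sheet function
`H` of `stub_resonanceFactorisation` at the diagonal point `(k+t,k+t,k+t)` is `2(ω(k+t)²+ω₂+2)cos(k+t) − 4`).
[folklore] -/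
theorem sheetFn_diag_hasDerivAt {ω₂ : ℝ} (hω : 0 ≤ ω₂) (k : ℝ) :
    HasDerivAt (fun t : ℝ => 2 * (dispersion ω₂ (k + t) ^ 2 + ω₂ + 2) * Real.cos (k + t) - 4)
      (4 * Real.sin k * (2 * Real.cos k - ω₂ - 2)) 0 := by
  have hfun : (fun t : ℝ => 2 * (dispersion ω₂ (k + t) ^ 2 + ω₂ + 2) * Real.cos (k + t) - 4) =
      fun t : ℝ => 2 * (2 * ω₂ + 4 - 2 * Real.cos (k + t)) * Real.cos (k + t) - 4 := by
    funext t
    rw [dispersion_sq hω]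
    ring
  rw [hfun]
  have hc : HasDerivAt (fun t : ℝ => Real.cos (k + t)) (-Real.sin k) 0 := by
    have h : HasDerivAt (fun t : ℝ => Real.cos (k + t)) (-Real.sin (k + 0)) 0 :=
      HasDerivAt.comp_const_add k 0 (Real.hasDerivAt_cos (k + 0))
    rwa [add_zero] at h
  have h := (((hc.const_mul 2).const_sub (2 * ω₂ + 4)).const_mul 2).mul hc
  have h' := h.sub_const 4
  refine h'.congr_deriv ?_
  simp only [add_zero]
  ring

/-- **Registered sub-goal `sheetFn_diag_deriv_ne_zero` (G-I3): at a triple point the sheet is transversal to the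
diagonal.** For `ω₂ > 0` and `cos k = c* = cosKappaStar ω₂`: the diagonal value `2(ω(k)² + ω₂ + 2)cos k − 4`
vanishes and its derivative along the diagonal does not:
`4 sin k (2cos k − ω₂ − 2) ≠ 0` (indeed `2c* − ω₂ − 2 = −√((ω₂+2)² − 4)` and `sin k ≠ 0`). [folklore] -/
theorem sheetFn_diag_deriv_ne_zero :
    ∀ ω₂ : ℝ, 0 < ω₂ → ∀ k : ℝ, Real.cos k = cosKappaStar ω₂ →
      2 * (dispersion ω₂ k ^ 2 + ω₂ + 2) * Real.cos k - 4 = 0 ∧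
        HasDerivAt (fun t : ℝ => 2 * (dispersion ω₂ (k + t) ^ 2 + ω₂ + 2) * Real.cos (k + t) - 4)
          (4 * Real.sin k * (2 * Real.cos k - ω₂ - 2)) 0 ∧
        4 * Real.sin k * (2 * Real.cos k - ω₂ - 2) ≠ 0 := by
  intro ω₂ hω k hk
  have hq := cosKappaStar_quadratic hω.le
  have hc1 := cosKappaStar_lt_one hω
  have hc0 := cosKappaStar_pos hω
  refine ⟨?_, sheetFn_diag_hasDerivAt hω.le k, ?_⟩
  · rw [dispersion_sq hω.le, hk]
    nlinarith [hq]
  · have hsin : Real.sin k ≠ 0 := by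
      intro hs
      have := Real.sin_sq_add_cos_sq k
      rw [hs, hk] at this
      nlinarith [hc1, hc0]
    have hlin : 2 * Real.cos k - ω₂ - 2 ≠ 0 := by
      rw [hk]
      intro h0
      have : cosKappaStar ω₂ = (ω₂ + 2) / 2 := by linarith
      rw [this] at hq
      nlinarith [hω]
    exact mul_ne_zero (mul_ne_zero four_ne_zero hsin) hlin

end Summit.AtomisticToContinuum.FouriersLaw.Theorems.DrudeDissolution.KineticPolymerGasOnTheTimeAxis

end
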